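import Literature.Analysis.FluidPDE.TorusNSLebesgueNormGrowthRate
import Literature.Analysis.FluidPDE.TorusNSSerrinCriterion
import Literature.Analysis.FluidPDE.ExtremeGrowthVorticityControl
import Literature.Analysis.FluidPDE.TorusNSChessboardTimeAverages
import Literature.Analysis.FluidPDE.TorusStrainVorticityIsometry
import HarnessLib

/-!
# Tran–Yu's pressure-moderation criterion on `T³`: `∫₀ᵀ ‖p‖²_{L^q}/‖u‖²_{L^q} dt < ∞`, `q > 3`,
# prevents blow-up

Analysis/FluidPDE proof file (theorems only; no definitions, no named facts).

search for candidate a priori estimates; no regularity claim (cell `pub-nsfunc`, literature seat: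
this file types a PUBLISHED conditional regularity criterion of the PRESSURE family in RATIO form;
nothing new).

Source: C. V. Tran, X. Yu, *Depletion of nonlinearity in the pressure force driving Navier–Stokes
flows*, Nonlinearity 28 (2015) 1295–1306, §2, Theorem 1 and Corollary 1 with their proof
(eqs. (9)–(14); held text `paper:doi-10-1088-0951-7715-28-5-1295`, p. 4). Printed (ℝ³, `ν = 1`,
`p` normalised to zero at infinity, `q ≥ 3`... here `q > 3`):

"**Theorem 1.** Let `u` and `p` solve the Navier–Stokes equations (1). If
`∫₀ᵗ ‖p‖²_{L^q}/‖u‖²_{L^q} dτ < ∞` (11), then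
`‖u‖_{L^q} ≤ ‖u₀‖_{L^q} exp{(q − 2) ∫₀ᵗ ‖p‖²_{L^q}/‖u‖²_{L^q} dτ} < ∞` (12) and regularity
follows." "**Corollary 1.** If `∫₀ᵗ ‖u‖⁴_{L^{2q}}/‖u‖²_{L^q} dτ < ∞` (13), then `‖u‖_{L^q} ≤
‖u₀‖_{L^q} exp{c(q − 2)∫₀ᵗ ‖u‖⁴_{L^{2q}}/‖u‖²_{L^q} dτ} < ∞` (14) and regularity follows."
Printed proof: the `L^q` energy balance tested with `|u|^{q−2}u`, the pressure term absorbed by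
Young into the dissipation `∫|u|^{q−2}|∇|u||²` ((9)–(10)), Hölder
`∫p²|u|^{q−2} ≤ ‖p‖²_{L^q}‖u‖^{q−2}_{L^q}`, Grönwall; Cor 1 from the Calderón–Zygmund bound
`‖p‖_{L^q} ≤ c‖u‖²_{L^{2q}}` ((3)).

Here on the unit torus `T^d`, `card d = 3`, in the tree's classical vocabulary and in CONTINUATION
FORM at a putative blow-up time (as the tree renders every `L^{γ,α}`-type criterion): the
hypothesis (11) becomes a continuous majorant `M(t)` of the RATIO, written without quotients,
`(∫|p(t) − c(t)|^q)^{2/q} ≤ M(t) (∫‖u(t)‖^q)^{2/q}` for an arbitrary normalisation `c(t)` of the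
pressure (on `T^d` the natural one is `c(t) = ⟨p(t)⟩`), with `∫₀ᵗ M ≤ I` on `[0, T)`.

* `TranYu2015.deriv_integral_norm_rpow_le_pressure` — (9)–(10): every one-sided derivative `R`
  of `s ↦ ∫‖u(s)‖^q` (`2 < q`) satisfies
  `R ≤ (q(q−2)/(4ν)) (∫|p(t) − c|^q)^{2/q} (∫‖u(t)‖^q)^{(q−2)/q}` for every constant `c`
  (the tree's balance `Torus.IsClassicalNSSolutionOn.deriv_integral_normSq_rpow_le_of_two_le`,
  RRS 2016 (11.19), for the solution `(u, p − c)`; Hölder `q/2`, `q/(q−2)`).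
* `Torus.classicalNS_integral_norm_rpow_le_mul_exp_of_pressure_ratio` — (12):
  `∫‖u(t)‖^q ≤ (∫‖u(0)‖^q) exp((q(q−2)/(4ν)) ∫₀ᵗ M)` on `[0, T)` (`2 < q`; Grönwall, tree
  `le_mul_exp_integral_of_hasDerivWithinAt_le_mul`).
* `Torus.classicalNS_continuation_of_pressure_ratio_integral_le` — **Theorem 1 on `T³`**
  (`3 < q`): the ratio majorant with bounded primitive ⇒ continuation past `T` ("regularity
  follows" = Serrin with the constant majorant `sup_t ‖u(t)‖_{L^q}`, `q > 3`, tree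
  `Torus.classicalNS_continuation_of_Ls_rpow_integral_le`).
* `Torus.classicalNS_continuation_of_L2q_Lq_ratio_integral_le` — **Corollary 1 on `T³`**
  (`3 < q`): `(∫‖u(t)‖^{2q})^{2/q} ≤ M(t)(∫‖u(t)‖^q)^{2/q}`, `∫₀ᵗ M ≤ I` ⇒ continuation
  (the tree's periodic Calderón–Zygmund bound `Torus.exists_pressure_sub_average_Ls_le_normSq`,
  Berselli–Galdi 2002 (1.6), with `c(t) = ⟨p(t)⟩`).
* `Torus.exists_classicalNS_integral_norm_pow_three_le_mul_exp_of_enstrophy_ratio` — **the bound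
  (16) of Corollary 2 on `T³`** (`q = 3`): there is `K ≥ 0` with
  `∫‖u(t)‖³ ≤ (∫‖u(0)‖³) exp((3K/(4ν)) ∫₀ᵗ M)` along classical mean-zero solutions whenever
  `(∫|ω(t)|²)² ≤ M(t) (∫‖u(t)‖³)^{2/3}` on `[0, T)` (the quotient-free form of (15)
  `‖ω‖⁴_{L²}/‖u‖²_{L³}`; (12) at `q = 3` with `c(t) = ⟨p(t)⟩`, the Calderón–Zygmund bound at
  `γ = 3`, the periodic Sobolev bound `∫|u|⁶ ≤ C_S(∫|∇u|²)³` and `∫|∇u|² = ∫|ω|²`). The printed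
  conclusion "and regularity follows" rests on `u ∈ L^∞(0,T;L³)` ⇒ regular
  (Escauriaza–Seregin–Šverák), which the tree does not have on `T³`: only the BOUND (16) is typed.

Scope (faithfulness): classical solutions with mean-zero velocity slices of the unforced system on
the unit torus (the paper: ℝ³); `q > 3` for the continuation statements (at `q = 3`
"regularity follows" from `u ∈ L^∞(0,T;L³)` is the Escauriaza–Seregin–Šverák theorem, not
available on `T³` in the tree — so of the printed Corollary 2, `∫₀ᵗ‖ω‖⁴_{L²}/‖u‖²_{L³} < ∞`,
only the `L³` BOUND (16) is typed, not the continuation); the constant in (10)/(12) is the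
tree's `q(q−2)/(4ν)` (Tran–Yu print `(q − 2)` at `ν = 1` after their absorption (9)); the
logarithmic improvement mentioned after (12) is not typed. Theorem 2 / Corollary 3 (`q = 4`):
`TorusNSTranYuL6L4RatioCriterion`. -- TODO(general form): `q = 3` continuation via ESS; Thms 3–5.

## Mathlib / tree search

Tree (used): `Torus.IsClassicalNSSolutionOn.deriv_integral_normSq_rpow_le_of_two_le`
(`TorusVelocityRealMomentBalance`), `Torus.exists_pressure_sub_average_Ls_le_normSq`
(`TorusNSBerselliGaldiCriterionLowest`), `Torus.hasDerivWithinAt_integral_of_convex`,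
`Torus.IsSmoothSpaceTimeOn.exists_norm_le_of_isCompact`, `Torus.gradient_sub_const_apply` (via the
private copies of the devices of `TorusNSLebesgueNormGrowthRate`),
`le_mul_exp_integral_of_hasDerivWithinAt_le_mul` (`ExtremeGrowthVorticityControl`),
`Torus.classicalNS_continuation_of_Ls_rpow_integral_le` (`TorusNSSerrinCriterion`),
`Torus.exists_integral_norm_pow_six_le_gradNormSq_cube` (`TorusNSChessboardTimeAverages`),
`integral_torusVorticitySqAt_eq_two_mul_torusEnstrophy` (`TorusStrainVorticityIsometry`); Mathlib
`integral_mul_le_Lp_mul_Lq_of_nonneg`. Searched (`lean search`, CRITERIA.md §A A7/A8):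
`pressure_ratio|TranYu2015|normRatio.*pressure` — the tree has the Berselli–Galdi pressure classes
(`TorusNSBerselliGaldiCriterion*`), the Seregin–Šverák one-sided pressure fact and Tran–Yu 2016/2017
restatements, not the 2015 ratio criterion — added here.

## References

* [TranYu2015] C. V. Tran, X. Yu, *Depletion of nonlinearity in the pressure force driving
  Navier–Stokes flows*, Nonlinearity 28 (2015) 1295–1306, doi:10.1088/0951-7715/28/5/1295 —
  Thm 1 (11)–(12), Cor 1 (13)–(14), Cor 2 (15)–(16), proof (9)–(10) (held text p. 4).
* [RobinsonRodrigoSadowskiCUP2016] J. C. Robinson, J. L. Rodrigo, W. Sadowski, *The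
  Three-Dimensional Navier–Stokes Equations*, CUP 2016, (11.19), Lemma 8.16 / Thm 8.17 (Serrin),
  via the tree files above.
* [BerselliGaldi2002] L. C. Berselli, G. P. Galdi, Proc. AMS 130 (2002), (1.6) (Calderón–Zygmund
  pressure bound, via the tree).
* [AyalaProtas2017] D. Ayala, B. Protas, J. Fluid Mech. 818 (2017), eq. (2.4)
  (`∫|∇×u|² = ∫|∇u|²`, via the tree).
-/

noncomputable section

open MeasureTheory Finset Set Filter Topology
open scoped InnerProductSpace RealInnerProductSpace ContDiff

namespace Literature.Analysis.FluidPDE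

open Literature.Analysis.FunctionSpaces

variable {d : Type*} [Fintype d] [DecidableEq d]

namespace TranYu2015

/-! ### §1 Helpers (private copies of tree devices) -/

/-- Shifting the pressure by a constant gives again a classical solution (same velocity, same
force): `∇(p − c) = ∇p`. (Copy of the tree's private device in `TorusNSLebesgueNormGrowthRate`.)
[folklore] -/
private theorem pressure_sub_const {S : Set ℝ} {ν : ℝ}
    {f u : ℝ → UnitAddTorus d → EuclideanSpace ℝ d} {p : ℝ → UnitAddTorus d → ℝ}
    (h : Torus.IsClassicalNSSolutionOn S ν f u p) (c : ℝ) :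
    Torus.IsClassicalNSSolutionOn S ν f u (fun t x => p t x - c) where
  smooth_velocity := h.smooth_velocity
  smooth_pressure :=
    h.smooth_pressure.sub (Torus.isSmoothSpaceTimeOn_const (Torus.isSmooth_const c) S)
  momentum t ht x := by
    rw [Torus.gradient_sub_const_apply]
    exact h.momentum t ht x
  divFree := h.divFree

omit [DecidableEq d] in
/-- Hölder on `T^d` with weights `a + b = 1` for continuous non-negative `f, g`:
`∫ f g ≤ (∫ f^{1/a})^a (∫ g^{1/b})^b`. [folklore] -/
private theorem integral_mul_le_rpow_mul_rpow {f g : UnitAddTorus d → ℝ} (hf : Continuous f)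
    (hg : Continuous g) (hf0 : ∀ x, 0 ≤ f x) (hg0 : ∀ x, 0 ≤ g x) {a b : ℝ} (ha : 0 < a)
    (hb : 0 < b) (hab : a + b = 1) :
    ∫ x, f x * g x ≤ (∫ x, f x ^ a⁻¹) ^ a * (∫ x, g x ^ b⁻¹) ^ b := by
  have hpq : (a⁻¹).HolderConjugate b⁻¹ := Real.HolderConjugate.inv_inv ha hb hab
  have h := integral_mul_le_Lp_mul_Lq_of_nonneg (μ := volume) hpq (ae_of_all _ hf0)
    (ae_of_all _ hg0) (hf.memLp_of_hasCompactSupport (HasCompactSupport.of_compactSpace f))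
    (hg.memLp_of_hasCompactSupport (HasCompactSupport.of_compactSpace g))
  simpa only [one_div, inv_inv] using h

omit [DecidableEq d] in
/-- `s ↦ ∫‖u(s)‖^q` is differentiable within `[a, b]` along a jointly smooth velocity (`q ≥ 2`):
dominated differentiation of `(‖u‖²)^{q/2}`. (Copy of the tree's private device in
`TorusNSLebesgueNormGrowthRate`.) [folklore] -/
private theorem hasDerivWithinAt_integral_norm_rpow {a b : ℝ}
    {u : ℝ → UnitAddTorus d → EuclideanSpace ℝ d} (hu : Torus.IsSmoothSpaceTimeOn (Icc a b) u)
    (hab : a < b) {q : ℝ} (hq : 2 ≤ q) {t : ℝ} (ht : t ∈ Icc a b) :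
    ∃ R : ℝ, HasDerivWithinAt (fun s => ∫ x, ‖u s x‖ ^ q) R (Icc a b) t := by
  set S : Set ℝ := Icc a b with hS
  have hU : UniqueDiffOn ℝ S := uniqueDiffOn_Icc hab
  set Q : ℝ → UnitAddTorus d → ℝ := fun s x => ‖u s x‖ ^ 2 with hQ
  have hQst : Torus.IsSmoothSpaceTimeOn S Q := by
    have h1 := hu.inner hu
    have e : Q = fun s x => ⟪u s x, u s x⟫ := by
      funext s x; rw [hQ, real_inner_self_eq_norm_sq]
    rw [e]; exact h1
  set Q' : ℝ → UnitAddTorus d → ℝ := Torus.timeDerivWithin S Q with hQ'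
  have hQ'st : Torus.IsSmoothSpaceTimeOn S Q' := hQst.timeDerivWithin hU
  obtain ⟨B₁, hB₁⟩ := hQst.exists_norm_le_of_isCompact isCompact_Icc subset_rfl
  obtain ⟨B₂, hB₂⟩ := hQ'st.exists_norm_le_of_isCompact isCompact_Icc subset_rfl
  have hB₁0 : 0 ≤ B₁ := (norm_nonneg _).trans (hB₁ t ht (0 : UnitAddTorus d))
  have hB₂0 : 0 ≤ B₂ := (norm_nonneg _).trans (hB₂ t ht (0 : UnitAddTorus d))
  have hr0 : 0 ≤ q / 2 - 1 := by linarith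
  have h1q : (1 : ℝ) ≤ q / 2 := by linarith
  set F : ℝ → UnitAddTorus d → ℝ := fun s x => (Q s x) ^ (q / 2) with hF
  set F' : ℝ → UnitAddTorus d → ℝ := fun s x => q / 2 * (Q s x) ^ (q / 2 - 1) * Q' s x with hF'
  have hQ0 : ∀ s x, 0 ≤ Q s x := fun s x => by rw [hQ]; positivity
  have hderiv : ∀ s ∈ S, ∀ x, HasDerivWithinAt (F · x) (F' s x) S s := by
    intro s hs x
    have h1 : HasDerivWithinAt (fun τ => Q τ x) (Q' s x) S s := hQst.hasDerivWithinAt_slice hs x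
    have h2 :=
      (Real.hasDerivAt_rpow_const (p := q / 2) (x := Q s x) (Or.inr h1q)).comp_hasDerivWithinAt s h1
    have e : F' s x = q / 2 * Q s x ^ (q / 2 - 1) * Q' s x := rfl
    rw [e]
    exact h2
  have hF_int : ∀ s ∈ S, Integrable (F s) volume := fun s hs =>
    (((hQst.isSmooth_slice hs).continuous).rpow_const
      fun x => Or.inr (by linarith)).integrable_unitAddTorus
  have hbound : ∀ᶠ s in 𝓝[S] t, ∀ x, ‖F' s x‖ ≤ q / 2 * B₁ ^ (q / 2 - 1) * B₂ := by
    refine eventually_nhdsWithin_of_forall fun s hs x => ?_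
    have hQle : Q s x ≤ B₁ := by
      have := hB₁ s hs x
      rw [Real.norm_of_nonneg (hQ0 s x)] at this
      exact this
    have h1 : Q s x ^ (q / 2 - 1) ≤ B₁ ^ (q / 2 - 1) := Real.rpow_le_rpow (hQ0 s x) hQle hr0
    have h2 : |Q' s x| ≤ B₂ := by
      have := hB₂ s hs x
      rwa [Real.norm_eq_abs] at this
    rw [hF', Real.norm_eq_abs]
    simp only
    rw [abs_mul, abs_mul, abs_of_nonneg (by linarith : (0 : ℝ) ≤ q / 2),
      abs_of_nonneg (Real.rpow_nonneg (hQ0 s x) _)]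
    have hq2 : (0 : ℝ) ≤ q / 2 := by linarith
    calc q / 2 * Q s x ^ (q / 2 - 1) * |Q' s x| ≤ q / 2 * B₁ ^ (q / 2 - 1) * B₂ := by
          gcongr
    _ = q / 2 * B₁ ^ (q / 2 - 1) * B₂ := rfl
  have hF'_meas : AEStronglyMeasurable (F' t) volume := by
    have hc : Continuous (F' t) :=
      ((continuous_const.mul (((hQst.isSmooth_slice ht).continuous).rpow_const
        fun x => Or.inr hr0)).mul (hQ'st.isSmooth_slice ht).continuous)
    exact hc.aestronglyMeasurable
  have hmain := Torus.hasDerivWithinAt_integral_of_convex (μ := volume) (convex_Icc a b) ht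
    hF_int hderiv hbound hF'_meas
  refine ⟨∫ x, F' t x, ?_⟩
  have e : (fun s => ∫ x, ‖u s x‖ ^ q) = fun s => ∫ x, F s x := by
    funext s
    refine integral_congr_ae (ae_of_all _ fun x => ?_)
    show ‖u s x‖ ^ q = (‖u s x‖ ^ 2) ^ (q / 2)
    rw [← Real.rpow_natCast, ← Real.rpow_mul (norm_nonneg _)]
    congr 1; push_cast; ring
  rw [e]
  exact hmain

/-! ### §2 The differential inequality (Tran–Yu (9)–(10)) -/

/-- **The `L^q` energy inequality with the pressure, Hölder form** (Tran–Yu 2015, (9)–(10):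
"`d/dt ‖u‖_{L^q} ≤ (q − 2) ‖p‖²_{L^q}/‖u‖²_{L^q} · ‖u‖_{L^q}` … where Hölder's inequality has been
used", from the `L^q` balance with the pressure term absorbed into the viscous one). On `T^d`,
along a classical solution of the unforced Navier–Stokes equations (`ν > 0`) on `[a, b] × T^d`,
for every real `q ≥ 2`... precisely `2 < q`, every `t ∈ [a, b]`, every one-sided derivative `R`
of `s ↦ ∫‖u(s)‖^q` within `[a, b]` at `t`, and EVERY constant `c` (pressure normalisation):
`R ≤ (q(q−2)/(4ν)) · (∫|p(t) − c|^q)^{2/q} · (∫‖u(t)‖^q)^{(q−2)/q}`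
(the tree's balance `R ≤ −qν∫|u|^{q−2}|∇u|² + ((q/2)(q/2−1)/ν)∫(p−c)²|u|^{q−2}`,
`Torus.IsClassicalNSSolutionOn.deriv_integral_normSq_rpow_le_of_two_le`, and Hölder with
exponents `q/2`, `q/(q−2)`; the constant is the tree's, Tran–Yu print `(q − 2)` at `ν = 1`).
[cite: TranYu2015, eqs. (9)–(10) (proof of Thm 1)] -/
theorem deriv_integral_norm_rpow_le_pressure {a b ν : ℝ}
    {u : ℝ → UnitAddTorus d → EuclideanSpace ℝ d} {p : ℝ → UnitAddTorus d → ℝ}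
    (h : Torus.IsClassicalNSSolutionOn (Icc a b) ν 0 u p) (hν : 0 < ν) (hab : a < b) {q : ℝ}
    (hq : 2 < q) {t : ℝ} (ht : t ∈ Icc a b) {R : ℝ}
    (hR : HasDerivWithinAt (fun s => ∫ x, ‖u s x‖ ^ q) R (Icc a b) t) (c : ℝ) :
    R ≤ q * (q - 2) / (4 * ν) * (∫ x, |p t x - c| ^ q) ^ (2 / q) *
      (∫ x, ‖u t x‖ ^ q) ^ ((q - 2) / q) := by
  have hq0 : 0 < q := by linarith
  have hq2 : 0 < q - 2 := by linarith
  have hqne : q ≠ 0 := hq0.ne'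
  have hq2ne : q - 2 ≠ 0 := hq2.ne'
  -- Step 0: the balance for the solution `(u, p − c)`
  have e_fun : (fun s => ∫ x, ‖u s x‖ ^ q) = fun s => ∫ x, (‖u s x‖ ^ 2) ^ (q / 2) := by
    funext s
    refine integral_congr_ae (ae_of_all _ fun x => ?_)
    show ‖u s x‖ ^ q = (‖u s x‖ ^ 2) ^ (q / 2)
    rw [← Real.rpow_natCast, ← Real.rpow_mul (norm_nonneg _)]
    congr 1; push_cast; ring
  rw [e_fun] at hR
  have h' := pressure_sub_const h c
  have hbal := h'.deriv_integral_normSq_rpow_le_of_two_le hν hab (α := q) (by linarith) ht hR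
  simp only [Pi.zero_apply, inner_zero_right, mul_zero, integral_zero, add_zero] at hbal
  -- notation
  have hut : Torus.IsSmooth (u t) := h.smooth_velocity.isSmooth_slice ht
  have hpt : Torus.IsSmooth (p t) := h.smooth_pressure.isSmooth_slice ht
  have hwc : Continuous fun x => ‖u t x‖ := hut.continuous.norm
  have hπc : Continuous fun x => p t x - c := hpt.continuous.sub continuous_const
  have hgrad0 : ∀ x, 0 ≤ ∑ k, ‖Torus.partialDeriv k (u t) x‖ ^ 2 := fun x =>
    Finset.sum_nonneg fun k _ => sq_nonneg _
  set X : ℝ := ∫ x, (‖u t x‖ ^ 2) ^ (q / 2 - 1) * ∑ k, ‖Torus.partialDeriv k (u t) x‖ ^ 2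
    with hX
  set U : ℝ := ∫ x, ‖u t x‖ ^ q with hU
  set Pq : ℝ := ∫ x, |p t x - c| ^ q with hPq
  set P : ℝ := ∫ x, (p t x - c) ^ 2 * (‖u t x‖ ^ 2) ^ (q / 2 - 1) with hP
  have hX0 : 0 ≤ X :=
    integral_nonneg fun x => mul_nonneg (Real.rpow_nonneg (sq_nonneg _) _) (hgrad0 x)
  have hU0 : 0 ≤ U := integral_nonneg fun x => Real.rpow_nonneg (norm_nonneg _) _
  have hPq0 : 0 ≤ Pq := integral_nonneg fun x => Real.rpow_nonneg (abs_nonneg _) _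
  -- `hbal : R ≤ -(q * ν * X) + q / 2 * (q / 2 - 1) / ν * P`
  -- Step 1 (Hölder, weights `2/q + (q−2)/q = 1`): `P ≤ Pq^{2/q} U^{(q−2)/q}`
  have hpw : ∀ (x : UnitAddTorus d) (r : ℝ), (‖u t x‖ ^ 2) ^ r = ‖u t x‖ ^ (2 * r) :=
    fun x r => by rw [← Real.rpow_natCast, ← Real.rpow_mul (norm_nonneg _)]; push_cast; ring_nf
  have hP_le : P ≤ Pq ^ (2 / q) * U ^ ((q - 2) / q) := by
    have ha' : 0 < 2 / q := by positivity
    have hb' : 0 < (q - 2) / q := by positivity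
    have hab' : 2 / q + (q - 2) / q = 1 := by field_simp; ring
    have hH := integral_mul_le_rpow_mul_rpow (f := fun x => (p t x - c) ^ 2)
      (g := fun x => (‖u t x‖ ^ 2) ^ (q / 2 - 1)) (hπc.pow 2)
      ((hwc.pow 2).rpow_const fun x => Or.inr (by linarith)) (fun x => sq_nonneg _)
      (fun x => Real.rpow_nonneg (sq_nonneg _) _) ha' hb' hab'
    have e1 : ∀ x, ((p t x - c) ^ 2) ^ (2 / q)⁻¹ = |p t x - c| ^ q := by
      intro x
      rw [← sq_abs, ← Real.rpow_natCast, ← Real.rpow_mul (abs_nonneg _), inv_div]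
      congr 1; push_cast; field_simp
    have e2 : ∀ x, ((‖u t x‖ ^ 2) ^ (q / 2 - 1)) ^ ((q - 2) / q)⁻¹ = ‖u t x‖ ^ q := by
      intro x
      rw [hpw x, ← Real.rpow_mul (norm_nonneg _), inv_div]
      congr 1
      field_simp
    simp only [e1, e2] at hH
    exact hH
  -- Step 2: drop the dissipation and combine
  have hcoef : 0 ≤ q / 2 * (q / 2 - 1) / ν := by
    have : 0 ≤ q / 2 * (q / 2 - 1) := by nlinarith
    positivity
  have hqνX : 0 ≤ q * ν * X := by positivity
  calc R ≤ -(q * ν * X) + q / 2 * (q / 2 - 1) / ν * P := hbal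
    _ ≤ q / 2 * (q / 2 - 1) / ν * P := by linarith
    _ ≤ q / 2 * (q / 2 - 1) / ν * (Pq ^ (2 / q) * U ^ ((q - 2) / q)) :=
        mul_le_mul_of_nonneg_left hP_le hcoef
    _ = q * (q - 2) / (4 * ν) * Pq ^ (2 / q) * U ^ ((q - 2) / q) := by
        field_simp
        ring

end TranYu2015

/-! ### §3 Theorem 1 and Corollary 1 along classical solutions on `T³` -/

section Criterion

variable {ν T : ℝ} {u : ℝ → UnitAddTorus d → EuclideanSpace ℝ d} {p : ℝ → UnitAddTorus d → ℝ}

/-- **Tran–Yu's bound (12) on `T³`: `‖u(t)‖_q^q ≤ ‖u₀‖_q^q exp(C ∫₀ᵗ ‖p‖²_q/‖u‖²_q)`.** Along a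
classical solution of the unforced Navier–Stokes equations (`ν > 0`) on `[0, T) × T^d`, `T > 0`,
for `2 < q`: if `M` is continuous on `[0, T)` and `‖p(t) − c(t)‖²_{L^q} ≤ M(t) ‖u(t)‖²_{L^q}` for
all `t ∈ [0, T)` (any normalisation `c(t)` of the pressure; written without quotients:
`(∫|p(t) − c(t)|^q)^{2/q} ≤ M(t) (∫‖u(t)‖^q)^{2/q}`), then
`∫‖u(t)‖^q ≤ (∫‖u(0)‖^q) · exp((q(q−2)/(4ν)) ∫₀ᵗ M)` for every `t ∈ [0, T)` (printed, `ν = 1`: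
"`‖u‖_{L^q} ≤ ‖u₀‖_{L^q} exp{(q − 2)∫₀ᵗ ‖p‖²_{L^q}/‖u‖²_{L^q} dτ}`"; Grönwall on
`TranYu2015.deriv_integral_norm_rpow_le_pressure`, the tree's
`le_mul_exp_integral_of_hasDerivWithinAt_le_mul`). [cite: TranYu2015, Thm 1 eq. (12)] -/
theorem Torus.classicalNS_integral_norm_rpow_le_mul_exp_of_pressure_ratio {q : ℝ} (hν : 0 < ν)
    (hq : 2 < q) (h : Torus.IsClassicalNSSolutionOn (Ico 0 T) ν 0 u p)
    {c M : ℝ → ℝ} (hMc : ContinuousOn M (Ico 0 T))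
    (hM : ∀ t ∈ Ico 0 T, (∫ x, |p t x - c t| ^ q) ^ (2 / q) ≤ M t * (∫ x, ‖u t x‖ ^ q) ^ (2 / q))
    {t : ℝ} (ht : t ∈ Ico 0 T) :
    ∫ x, ‖u t x‖ ^ q ≤
      (∫ x, ‖u 0 x‖ ^ q) * Real.exp (q * (q - 2) / (4 * ν) * ∫ τ in (0 : ℝ)..t, M τ) := by
  have hq0 : 0 < q := by linarith
  have hq2 : (2 : ℝ) ≤ q := hq.le
  set X : ℝ → ℝ := fun s => ∫ x, ‖u s x‖ ^ q with hX
  have hXnn : ∀ s, 0 ≤ X s := fun s => integral_nonneg fun x => Real.rpow_nonneg (norm_nonneg _) _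
  rcases ht.1.eq_or_lt with h0 | h0t
  · rw [← h0]; simp
  have hsub : Icc 0 t ⊆ Ico 0 T := fun s hs => ⟨hs.1, hs.2.trans_lt ht.2⟩
  have h' : Torus.IsClassicalNSSolutionOn (Icc 0 t) ν 0 u p := h.mono hsub (uniqueDiffOn_Icc h0t)
  have hder : ∀ s ∈ Icc 0 t, ∃ R, HasDerivWithinAt X R (Icc 0 t) s := fun s hs =>
    TranYu2015.hasDerivWithinAt_integral_norm_rpow h'.smooth_velocity h0t hq2 hs
  choose! Xd hXd using hder
  set k : ℝ → ℝ := fun s => q * (q - 2) / (4 * ν) * M s with hk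
  have hkc : ContinuousOn k (Icc 0 t) := continuousOn_const.mul (hMc.mono hsub)
  have hle : ∀ s ∈ Icc 0 t, Xd s ≤ k s * X s := by
    intro s hs
    have h1 := TranYu2015.deriv_integral_norm_rpow_le_pressure h' hν h0t hq hs (hXd s hs) (c s)
    have hU0 : 0 ≤ X s := hXnn s
    have h2 : (∫ x, |p s x - c s| ^ q) ^ (2 / q) * X s ^ ((q - 2) / q) ≤ M s * X s := by
      have h3 := mul_le_mul_of_nonneg_right (hM s (hsub hs)) (Real.rpow_nonneg hU0 ((q - 2) / q))
      refine h3.trans (le_of_eq ?_)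
      have e : 2 / q + (q - 2) / q = 1 := by
        rw [← add_div, show (2 : ℝ) + (q - 2) = q by ring, div_self hq0.ne']
      rw [mul_assoc, ← Real.rpow_add' hU0 (by rw [e]; norm_num), e, Real.rpow_one]
    have hcoef : 0 ≤ q * (q - 2) / (4 * ν) := by
      have : 0 ≤ q * (q - 2) := by nlinarith
      positivity
    calc Xd s ≤ q * (q - 2) / (4 * ν) * (∫ x, |p s x - c s| ^ q) ^ (2 / q) *
          (∫ x, ‖u s x‖ ^ q) ^ ((q - 2) / q) := h1
      _ = q * (q - 2) / (4 * ν) * ((∫ x, |p s x - c s| ^ q) ^ (2 / q) * X s ^ ((q - 2) / q)) := by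
          rw [hX]; ring
      _ ≤ q * (q - 2) / (4 * ν) * (M s * X s) := mul_le_mul_of_nonneg_left h2 hcoef
      _ = k s * X s := by rw [hk]; ring
  have hG := le_mul_exp_integral_of_hasDerivWithinAt_le_mul h0t hXd hkc hle ⟨h0t.le, le_rfl⟩
  have e : ∫ s in (0 : ℝ)..t, k s = q * (q - 2) / (4 * ν) * ∫ τ in (0 : ℝ)..t, M τ := by
    rw [hk]; exact intervalIntegral.integral_const_mul _ _
  rw [e] at hG
  exact hG

/-- **Tran–Yu's Theorem 1 on `T³` (continuation form): `∫₀ᵀ ‖p‖²_{L^q}/‖u‖²_{L^q} < ∞`, `q > 3`,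
prevents blow-up.** Printed (ℝ³, `ν = 1`, `p` normalised to zero at infinity): "Let `u` and `p`
solve the Navier–Stokes equations. If `∫₀ᵗ ‖p‖²_{L^q}/‖u‖²_{L^q} dτ < ∞` (11), then
`‖u‖_{L^q} ≤ ‖u₀‖_{L^q} exp{(q − 2)∫₀ᵗ ‖p‖²_{L^q}/‖u‖²_{L^q} dτ} < ∞` (12) and regularity follows."
Here: a classical solution of the unforced Navier–Stokes equations (`ν > 0`) on `[0, T) × T^d`,
`card d = 3`, `T > 0`, with mean-zero velocity slices, `3 < q < ∞`, a continuous `M` on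
`[0, T)` with `(∫|p(t) − c(t)|^q)^{2/q} ≤ M(t) (∫‖u(t)‖^q)^{2/q}` (any normalisation `c(t)`) and
`∫₀ᵗ M ≤ I` on `[0, T)`: then the solution continues to a classical solution with mean-zero slices
on some `[0, T'] × T^d`, `T' > T`, equal to `u` on `[0, T)`. Proof: (12)
(`Torus.classicalNS_integral_norm_rpow_le_mul_exp_of_pressure_ratio`) bounds `sup_t ‖u(t)‖_{L^q}`;
"regularity follows" = Serrin with the constant majorant (tree
`Torus.classicalNS_continuation_of_Ls_rpow_integral_le`, `q > 3`).
[cite: TranYu2015, Thm 1 (11)–(12)] -/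
theorem Torus.classicalNS_continuation_of_pressure_ratio_integral_le (hd : Fintype.card d = 3)
    {q : ℝ} (hν : 0 < ν) (hT : 0 < T) (hq : 3 < q)
    (h : Torus.IsClassicalNSSolutionOn (Ico 0 T) ν 0 u p)
    (hmean : ∀ t ∈ Ico 0 T, Torus.HasZeroMean (u t)) {c M : ℝ → ℝ}
    (hMc : ContinuousOn M (Ico 0 T))
    (hM : ∀ t ∈ Ico 0 T, (∫ x, |p t x - c t| ^ q) ^ (2 / q) ≤ M t * (∫ x, ‖u t x‖ ^ q) ^ (2 / q))
    {I : ℝ} (hI : ∀ t ∈ Ico 0 T, ∫ τ in (0 : ℝ)..t, M τ ≤ I) :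
    ∃ T' : ℝ, T < T' ∧ ∃ (u' : ℝ → UnitAddTorus d → EuclideanSpace ℝ d)
      (p' : ℝ → UnitAddTorus d → ℝ), Torus.IsClassicalNSSolutionOn (Icc 0 T') ν 0 u' p' ∧
        (∀ t ∈ Icc 0 T', Torus.HasZeroMean (u' t)) ∧ ∀ t ∈ Ico 0 T, u' t = u t := by
  have hq0 : 0 < q := by linarith
  have hq3 : 0 < q - 3 := by linarith
  set C : ℝ := q * (q - 2) / (4 * ν) with hC
  have hC0 : 0 ≤ C := by
    have : 0 ≤ q * (q - 2) := by nlinarith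
    rw [hC]; positivity
  set B : ℝ := (∫ x, ‖u 0 x‖ ^ q) * Real.exp (C * I) with hB
  have hU00 : 0 ≤ ∫ x, ‖u 0 x‖ ^ q := integral_nonneg fun x => Real.rpow_nonneg (norm_nonneg _) _
  have hB0 : 0 ≤ B := mul_nonneg hU00 (Real.exp_pos _).le
  have hbound : ∀ t ∈ Ico 0 T, ∫ x, ‖u t x‖ ^ q ≤ B := by
    intro t ht
    have h1 := Torus.classicalNS_integral_norm_rpow_le_mul_exp_of_pressure_ratio hν
      (by linarith) h hMc hM ht
    refine h1.trans (mul_le_mul_of_nonneg_left ?_ hU00)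
    exact Real.exp_le_exp.2 (mul_le_mul_of_nonneg_left (hI t ht) hC0)
  refine Torus.classicalNS_continuation_of_Ls_rpow_integral_le hd hν hT hq h hmean
    (N := fun _ => B ^ (1 / q)) continuousOn_const (fun _ _ => Real.rpow_nonneg hB0 _)
    (fun t ht => Real.rpow_le_rpow (integral_nonneg fun x => Real.rpow_nonneg (norm_nonneg _) _)
      (hbound t ht) (by positivity))
    (I := T * (B ^ (1 / q)) ^ (2 * q / (q - 3))) fun t ht => ?_
  rw [intervalIntegral.integral_const, smul_eq_mul, sub_zero]
  exact mul_le_mul_of_nonneg_right ht.2.le (Real.rpow_nonneg (Real.rpow_nonneg hB0 _) _)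

/-- **Tran–Yu's Corollary 1 on `T³`: `∫₀ᵀ ‖u‖⁴_{L^{2q}}/‖u‖²_{L^q} < ∞`, `q > 3`, prevents
blow-up.** Printed: "If `∫₀ᵗ ‖u‖⁴_{L^{2q}}/‖u‖²_{L^q} dτ < ∞` (13), then `‖u‖_{L^q} ≤
‖u₀‖_{L^q} exp{c(q − 2)∫₀ᵗ ‖u‖⁴_{L^{2q}}/‖u‖²_{L^q} dτ} < ∞` (14) and regularity follows" (from
Thm 1 by the Calderón–Zygmund bound `‖p‖_{L^q} ≤ c‖u‖²_{L^{2q}}`, their (3)). Here, with the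
tree's periodic bound `(∫|p − ⟨p⟩|^q)^{1/q} ≤ C_P (∫(‖u‖²)^q)^{1/q}`
(`Torus.exists_pressure_sub_average_Ls_le_normSq`): a classical mean-zero solution of the
unforced equations on `[0, T) × T^d`, `card d = 3`, `3 < q`, a continuous `M` with
`(∫‖u(t)‖^{2q})^{2/q} ≤ M(t) (∫‖u(t)‖^q)^{2/q}` and `∫₀ᵗ M ≤ I` on `[0, T)` continues past `T`.
[cite: TranYu2015, Cor 1 (13)–(14)] -/
theorem Torus.classicalNS_continuation_of_L2q_Lq_ratio_integral_le (hd : Fintype.card d = 3)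
    {q : ℝ} (hν : 0 < ν) (hT : 0 < T) (hq : 3 < q)
    (h : Torus.IsClassicalNSSolutionOn (Ico 0 T) ν 0 u p)
    (hmean : ∀ t ∈ Ico 0 T, Torus.HasZeroMean (u t)) {M : ℝ → ℝ}
    (hMc : ContinuousOn M (Ico 0 T))
    (hM : ∀ t ∈ Ico 0 T,
      (∫ x, ‖u t x‖ ^ (2 * q)) ^ (2 / q) ≤ M t * (∫ x, ‖u t x‖ ^ q) ^ (2 / q))
    {I : ℝ} (hI : ∀ t ∈ Ico 0 T, ∫ τ in (0 : ℝ)..t, M τ ≤ I) :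
    ∃ T' : ℝ, T < T' ∧ ∃ (u' : ℝ → UnitAddTorus d → EuclideanSpace ℝ d)
      (p' : ℝ → UnitAddTorus d → ℝ), Torus.IsClassicalNSSolutionOn (Icc 0 T') ν 0 u' p' ∧
        (∀ t ∈ Icc 0 T', Torus.HasZeroMean (u' t)) ∧ ∀ t ∈ Ico 0 T, u' t = u t := by
  haveI : Nonempty d := by rw [← Fintype.card_pos_iff, hd]; norm_num
  have hq0 : 0 < q := by linarith
  obtain ⟨CP, hCP0, hCP⟩ :=
    Torus.exists_pressure_sub_average_Ls_le_normSq (d := d) (γ := q) (by linarith)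
  -- the pressure-ratio majorant `CP² M` with `c(t) = ⟨p(t)⟩`
  refine Torus.classicalNS_continuation_of_pressure_ratio_integral_le hd hν hT hq h hmean
    (c := fun t => ∫ y, p t y) (M := fun t => CP ^ 2 * M t) (continuousOn_const.mul hMc)
    (fun t ht => ?_) (I := CP ^ 2 * I) (fun t ht => ?_)
  · -- at time `t`, on the window `[0, b]`, `b = (t + T)/2`
    set b : ℝ := (t + T) / 2 with hb
    have htb : t < b := by rw [hb]; linarith [ht.2]
    have hbT : b < T := by rw [hb]; linarith [ht.2]
    have h0b : 0 < b := lt_of_le_of_lt ht.1 htb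
    have hsub : Icc 0 b ⊆ Ico 0 T := fun s hs => ⟨hs.1, hs.2.trans_lt hbT⟩
    have h' : Torus.IsClassicalNSSolutionOn (Icc 0 b) ν 0 u p :=
      h.mono hsub (uniqueDiffOn_Icc h0b)
    have hπ := hCP h0b h' t ⟨ht.1, htb.le⟩
    have hA0 : 0 ≤ ∫ x, (‖u t x‖ ^ 2) ^ q :=
      integral_nonneg fun x => Real.rpow_nonneg (sq_nonneg _) _
    have hI0 : 0 ≤ ∫ x, |p t x - ∫ y, p t y| ^ q :=
      integral_nonneg fun x => Real.rpow_nonneg (abs_nonneg _) _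
    have e2q : ∫ x, (‖u t x‖ ^ 2) ^ q = ∫ x, ‖u t x‖ ^ (2 * q) := by
      refine integral_congr_ae (ae_of_all _ fun x => ?_)
      show (‖u t x‖ ^ 2) ^ q = ‖u t x‖ ^ (2 * q)
      rw [← Real.rpow_natCast, ← Real.rpow_mul (norm_nonneg _)]
      push_cast; ring_nf
    -- square the Calderón–Zygmund bound: `Π^{2/q} ≤ CP² A^{2/q}`
    have hsq : ((∫ x, |p t x - ∫ y, p t y| ^ q) ^ (1 / q)) ^ (2 : ℝ) ≤
        (CP * (∫ x, (‖u t x‖ ^ 2) ^ q) ^ (1 / q)) ^ (2 : ℝ) :=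
      Real.rpow_le_rpow (Real.rpow_nonneg hI0 _) hπ (by norm_num)
    rw [← Real.rpow_mul hI0, Real.mul_rpow hCP0 (Real.rpow_nonneg hA0 _), ← Real.rpow_mul hA0,
      show (1 : ℝ) / q * 2 = 2 / q by ring, e2q, Real.rpow_two] at hsq
    calc (∫ x, |p t x - ∫ y, p t y| ^ q) ^ (2 / q)
        ≤ CP ^ 2 * (∫ x, ‖u t x‖ ^ (2 * q)) ^ (2 / q) := hsq
      _ ≤ CP ^ 2 * (M t * (∫ x, ‖u t x‖ ^ q) ^ (2 / q)) :=
          mul_le_mul_of_nonneg_left (hM t ht) (sq_nonneg _)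
      _ = CP ^ 2 * M t * (∫ x, ‖u t x‖ ^ q) ^ (2 / q) := by ring
  · rw [intervalIntegral.integral_const_mul]
    exact mul_le_mul_of_nonneg_left (hI t ht) (sq_nonneg _)

/-- **Tran–Yu's bound (16) (Corollary 2, `q = 3`) on `T³`:
`‖u(t)‖_{L³} ≤ ‖u₀‖_{L³} exp(c∫₀ᵗ ‖ω‖⁴_{L²}/‖u‖²_{L³})`.** Printed: "For `q = 3`, one can
substitute (3) and the Sobolev inequality `‖u‖_{L⁶} ≤ c‖ω‖_{L²}` into (10) and obtain the
following regularity criterion. **Corollary 2.** If `∫₀ᵗ ‖ω‖⁴_{L²}/‖u‖²_{L³} dτ < ∞` (15), then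
`‖u‖_{L^q} ≤ ‖u₀‖_{L^q} exp{c(q − 2)∫₀ᵗ ‖ω‖⁴_{L²}/‖u‖²_{L³} dτ} < ∞` (16) and regularity
follows." Here the BOUND (16) at `q = 3`: there is `K ≥ 0` (`K = C_P² C_S^{2/3}`, the tree's
periodic Calderón–Zygmund constant at `γ = 3` and Sobolev constant) such that along every
classical solution of the unforced Navier–Stokes equations (`ν > 0`) on `[0, T) × T^d`,
`card d = 3`, with mean-zero velocity slices: if `M` is continuous on `[0, T)` and
`(∫|ω(t)|²)² ≤ M(t) (∫‖u(t)‖³)^{2/3}` for all `t ∈ [0, T)` (`|ω|² = torusVorticitySqAt`; the ratio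
`‖ω‖⁴_{L²}/‖u‖²_{L³} ≤ M` without quotients), then
`∫‖u(t)‖³ ≤ (∫‖u(0)‖³) exp((3K/(4ν)) ∫₀ᵗ M)` on `[0, T)` — (12) at `q = 3`
(`Torus.classicalNS_integral_norm_rpow_le_mul_exp_of_pressure_ratio`, `c(t) = ⟨p(t)⟩`), the
Calderón–Zygmund bound `(∫|p − ⟨p⟩|³)^{1/3} ≤ C_P(∫‖u‖⁶)^{1/3}`
(`Torus.exists_pressure_sub_average_Ls_le_normSq`), the periodic Sobolev bound
`∫‖u‖⁶ ≤ C_S(∫|∇u|²)³` (`Torus.exists_integral_norm_pow_six_le_gradNormSq_cube`) and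
`∫|∇u|² = ∫|ω|²` (`integral_torusVorticitySqAt_eq_two_mul_torusEnstrophy`). The printed "and
regularity follows" (`u ∈ L^∞(0,T;L³)` ⇒ regular, Escauriaza–Seregin–Šverák) is NOT typed on
`T³`. [cite: TranYu2015, Cor 2 eqs. (15)–(16)] -/
theorem Torus.exists_classicalNS_integral_norm_pow_three_le_mul_exp_of_enstrophy_ratio
    (hd : Fintype.card d = 3) :
    ∃ K : ℝ, 0 ≤ K ∧ ∀ {ν T : ℝ} {u : ℝ → UnitAddTorus d → EuclideanSpace ℝ d}
      {p : ℝ → UnitAddTorus d → ℝ}, 0 < ν → Torus.IsClassicalNSSolutionOn (Ico 0 T) ν 0 u p →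
        (∀ t ∈ Ico 0 T, Torus.HasZeroMean (u t)) → ∀ {M : ℝ → ℝ}, ContinuousOn M (Ico 0 T) →
          (∀ t ∈ Ico 0 T, (∫ x, torusVorticitySqAt (u t) x) ^ 2 ≤
            M t * (∫ x, ‖u t x‖ ^ (3 : ℝ)) ^ (2 / 3 : ℝ)) →
            ∀ t ∈ Ico 0 T, ∫ x, ‖u t x‖ ^ (3 : ℝ) ≤
              (∫ x, ‖u 0 x‖ ^ (3 : ℝ)) * Real.exp (3 * K / (4 * ν) * ∫ τ in (0 : ℝ)..t, M τ) := by
  haveI : Nonempty d := by rw [← Fintype.card_pos_iff, hd]; norm_num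
  obtain ⟨CP, hCP0, hCP⟩ :=
    Torus.exists_pressure_sub_average_Ls_le_normSq (d := d) (γ := 3) (by norm_num)
  obtain ⟨CS, hCS0, hCS⟩ := Torus.exists_integral_norm_pow_six_le_gradNormSq_cube (d := d) hd
  set K : ℝ := CP ^ 2 * CS ^ (2 / 3 : ℝ) with hK
  have hK0 : 0 ≤ K := mul_nonneg (sq_nonneg _) (Real.rpow_nonneg hCS0 _)
  refine ⟨K, hK0, fun {ν T u p} hν h hmean {M} hMc hM t ht => ?_⟩
  -- (12) at `q = 3` with the majorant `K · M` and `c(t) = ⟨p(t)⟩`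
  have h12 := Torus.classicalNS_integral_norm_rpow_le_mul_exp_of_pressure_ratio (q := 3) hν
    (by norm_num) h (c := fun t => ∫ y, p t y) (M := fun t => K * M t)
    (continuousOn_const.mul hMc) (fun s hs => ?_) ht
  · have e : (3 : ℝ) * (3 - 2) / (4 * ν) * ∫ τ in (0 : ℝ)..t, K * M τ =
        3 * K / (4 * ν) * ∫ τ in (0 : ℝ)..t, M τ := by
      rw [intervalIntegral.integral_const_mul]; ring
    rw [e] at h12
    exact h12
  · -- at time `s`, on the window `[0, b]`, `b = (s + T)/2`
    set b : ℝ := (s + T) / 2 with hb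
    have hsb : s < b := by rw [hb]; linarith [hs.2]
    have hbT : b < T := by rw [hb]; linarith [hs.2]
    have h0b : 0 < b := lt_of_le_of_lt hs.1 hsb
    have hsub : Icc 0 b ⊆ Ico 0 T := fun r hr => ⟨hr.1, hr.2.trans_lt hbT⟩
    have h' : Torus.IsClassicalNSSolutionOn (Icc 0 b) ν 0 u p :=
      h.mono hsub (uniqueDiffOn_Icc h0b)
    have hus : Torus.IsSmooth (u s) := h.smooth_velocity.isSmooth_slice hs
    have hdivs : Torus.IsDivFree (u s) := h.divFree s hs
    have hπ := hCP h0b h' s ⟨hs.1, hsb.le⟩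
    -- `(∫|p−⟨p⟩|³)^{1/3} ≤ CP (∫(‖u‖²)³)^{1/3}`
    have hA0 : 0 ≤ ∫ x, (‖u s x‖ ^ 2) ^ (3 : ℝ) :=
      integral_nonneg fun x => Real.rpow_nonneg (sq_nonneg _) _
    have hI0 : 0 ≤ ∫ x, |p s x - ∫ y, p s y| ^ (3 : ℝ) :=
      integral_nonneg fun x => Real.rpow_nonneg (abs_nonneg _) _
    have e6 : ∫ x, (‖u s x‖ ^ 2) ^ (3 : ℝ) = ∫ x, ‖u s x‖ ^ 6 :=
      integral_congr_ae (ae_of_all _ fun x => by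
        show (‖u s x‖ ^ 2) ^ (3 : ℝ) = ‖u s x‖ ^ 6
        rw [show (3 : ℝ) = ((3 : ℕ) : ℝ) by norm_num, Real.rpow_natCast]; ring)
    -- Sobolev and `∫|∇u|² = ∫|ω|²`
    have hω : ∫ x, torusVorticitySqAt (u s) x = Torus.gradNormSq (u s) := by
      rw [integral_torusVorticitySqAt_eq_two_mul_torusEnstrophy hus hdivs, torusEnstrophy]; ring
    have hW0 : 0 ≤ ∫ x, torusVorticitySqAt (u s) x :=
      integral_nonneg fun x => torusVorticitySqAt_nonneg _ x
    have h6 : ∫ x, ‖u s x‖ ^ 6 ≤ CS * (∫ x, torusVorticitySqAt (u s) x) ^ 3 := by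
      rw [hω]; exact hCS (u s) hus (hmean s hs)
    have hU60 : 0 ≤ ∫ x, ‖u s x‖ ^ 6 := integral_nonneg fun x => pow_nonneg (norm_nonneg _) _
    -- square of the Calderón–Zygmund bound: `Π^{2/3} ≤ CP² (∫‖u‖⁶)^{2/3}`
    have hsq : ((∫ x, |p s x - ∫ y, p s y| ^ (3 : ℝ)) ^ (1 / (3 : ℝ))) ^ (2 : ℝ) ≤
        (CP * (∫ x, (‖u s x‖ ^ 2) ^ (3 : ℝ)) ^ (1 / (3 : ℝ))) ^ (2 : ℝ) :=
      Real.rpow_le_rpow (Real.rpow_nonneg hI0 _) hπ (by norm_num)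
    rw [← Real.rpow_mul hI0, Real.mul_rpow hCP0 (Real.rpow_nonneg hA0 _), ← Real.rpow_mul hA0,
      show (1 : ℝ) / 3 * 2 = 2 / 3 by ring, e6, Real.rpow_two] at hsq
    -- `(∫‖u‖⁶)^{2/3} ≤ CS^{2/3} (∫|ω|²)²`
    have h6' : (∫ x, ‖u s x‖ ^ 6) ^ (2 / 3 : ℝ) ≤
        CS ^ (2 / 3 : ℝ) * (∫ x, torusVorticitySqAt (u s) x) ^ 2 := by
      calc (∫ x, ‖u s x‖ ^ 6) ^ (2 / 3 : ℝ)
          ≤ (CS * (∫ x, torusVorticitySqAt (u s) x) ^ 3) ^ (2 / 3 : ℝ) :=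
            Real.rpow_le_rpow hU60 h6 (by norm_num)
        _ = CS ^ (2 / 3 : ℝ) * (∫ x, torusVorticitySqAt (u s) x) ^ 2 := by
            rw [Real.mul_rpow hCS0 (pow_nonneg hW0 _), ← Real.rpow_natCast,
              ← Real.rpow_mul hW0]
            norm_num
    calc (∫ x, |p s x - ∫ y, p s y| ^ (3 : ℝ)) ^ (2 / (3 : ℝ))
        ≤ CP ^ 2 * (∫ x, ‖u s x‖ ^ 6) ^ (2 / 3 : ℝ) := hsq
      _ ≤ CP ^ 2 * (CS ^ (2 / 3 : ℝ) * (∫ x, torusVorticitySqAt (u s) x) ^ 2) :=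
          mul_le_mul_of_nonneg_left h6' (sq_nonneg _)
      _ ≤ CP ^ 2 * (CS ^ (2 / 3 : ℝ) * (M s * (∫ x, ‖u s x‖ ^ (3 : ℝ)) ^ (2 / 3 : ℝ))) :=
          mul_le_mul_of_nonneg_left (mul_le_mul_of_nonneg_left (hM s hs)
            (Real.rpow_nonneg hCS0 _)) (sq_nonneg _)
      _ = K * M s * (∫ x, ‖u s x‖ ^ (3 : ℝ)) ^ (2 / (3 : ℝ)) := by rw [hK]; ring

end Criterion

end Literature.Analysis.FluidPDE

end
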